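/-
Copyright: seat `ym-line-sll-p3` (prover-ym-line-sll-p3-g0-0), route `SoftLoopLongLag`, crux `SoftLoopLagFloorToTorus`
(stmt-QuantumFields-22504), line `birth` (skeleton v6) — registered stub K1r.
-/
import Summits.QuantumFields.YangMills.Theorems.SoftLoopLongLagSoftLoopLagFloorToTorusDlrTransferGoodFloorG

/-!
# Registered stub K1r `stub_dlrTransferG_of_goodFloor_of_smoothRate` of crux K′ `SoftLoopLagFloorToTorus` (stmt-QuantumFields-22504, skeleton v6),
# BY NAME — the DLR transfer box → torus with an abstract mean-smoothness RATE, every compact gauge group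

WHAT.  Parameters `ε a κ c` and a rate `ρ : ℝ → ℝ` with `ρ(β)² = o(⌈β^ε⌉³β^{-2})` (hypothesis: `∀ θ > 0, ∃ β₀, ∀ β ≥ β₀, ρ β² ≤ θ·⌈β^ε⌉³·β^{-2}`);
inputs, both for data `η` that are crude-good at scale `β^{κ/2−1}` on the plaquettes touching `Λ_n` (`n = ⌈β^a⌉`) and whose kernel charges the hot event
(threshold `β^{κ−1}`) by `≤ e^{−β^{κ/4}}`: the box floor `c·R³·β^{-2} ≤ Cov_{ν_η}(F_R, F_R∘α_R)` (`R = ⌈β^ε⌉`, the conclusion of T′ rev 3) and the mean smoothness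
`|ν_η(F_R∘α_R) − ν_η(F_R)| ≤ ρ β` (the conclusion of `condMeanSmooth_of_innerMixture`); conclusion `∃ β₀, ∀ β ≥ β₀, ∀ᶠ L, (c/8)·R³·β^{-2} ≤ torusLagCov r β L F_R R`.
The window hypothesis `13ε + κ < 2a` is carried (registered) but not needed: the rate hypothesis at `θ := c/8` replaces the window arithmetic of K1⁺⁺.
PROOF = `dlrTransferG_of_goodFloor_of_smooth_delta` (module `…DlrTransferGoodFloorG`) at `δ := κ/4` verbatim, with `ε₀ := ρ β`, `ε₀²/2 ≤ θ₀/16`: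
exceptional event `{lift ∉ crude-good(κ/4)} ∪ {γ_{lift}(Φ) > e^{−β^{κ/4}}}` (torus mass `≤ 32(2n+3)⁴e^{−β^{κ/4}}`: union bound + Markov/DLR/torus rarity),
inner step `boxKernel_lagCov_ge_of_coldTypical`, `total_covariance_lower_bound_sub`.

HONEST LABEL: rung R2xi-G RECORD label (leaf `WeakCouplingRates.XiPow`, an UPPER bound on the lattice mass gap for every compact simple `G`); NOT the Clay
mass gap; no summit statement is touched.

References: H.-O. Georgii, *Gibbs Measures and Phase Transitions* (2011) Thm. 4.17; R. Durrett, *Probability* (2019) §1.6, §4.1.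
-/

set_option autoImplicit false

noncomputable section

open MeasureTheory Filter Topology
open Literature.Probability.LatticeModels (Site box mem_box)
open Literature.MathematicalPhysics Literature.MathematicalPhysics.QuantumFieldTheory
open Literature.MathematicalPhysics.QuantumLattice
open Summit.QuantumFields.YangMills.Theorems.WeakCouplingRates
open Summit.QuantumFields.YangMills.Theorems.ColdBoxAllGroups (plaquetteLargeFieldRarityG_of_latticeRep)

namespace Summit.QuantumFields.YangMills.Theorems.SoftLoopLongLag

/-- **Registered stub K1r `stub_dlrTransferG_of_goodFloor_of_smoothRate` (crux stmt-QuantumFields-22504, skeleton v6)**, by name and signature: box floor for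
crude-good cold-typical data ∧ outer mean smoothness at any rate `ρ(β) = o(R^{3/2}β^{-1})` ⇒ eventually in the torus side `(c/8)·R³β^{-2} ≤ torusLagCov`
(Georgii 2011 Thm. 4.17; Durrett 2019 §4.1). [folklore] -/
theorem stub_dlrTransferG_of_goodFloor_of_smoothRate :
    ∀ (G : Type) [Group G] [TopologicalSpace G] [IsTopologicalGroup G] [CompactSpace G] [MeasurableSpace G] [BorelSpace G]
      (r : LatticeRep G) (ε a κ c : ℝ) (ρ : ℝ → ℝ), 0 < ε → 0 < κ → κ < 1 → 0 < c → 13 * ε + κ < 2 * a →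
      (∀ θ : ℝ, 0 < θ → ∃ β₀ : ℝ, ∀ β : ℝ, β₀ ≤ β → ρ β ^ 2 ≤ θ * (⌈β ^ ε⌉₊ : ℝ) ^ 3 * β ^ (-(2 : ℝ))) →
      (∃ β₀ : ℝ, ∀ β : ℝ, β₀ ≤ β → ∀ η : LGConfig 4 G,
          (∀ p ∈ plaquettesTouching (lagBox ⌈β ^ a⌉₊),
            (r.N : ℝ) - plaquetteObs r.ρ p.1 p.2.1.1 p.2.1.2 η ≤ β ^ (κ / 2 - 1)) →
          ymSpecification (d := 4) r.ρ β (lagBox ⌈β ^ a⌉₊) η (coldEvent r β κ (lagBox ⌈β ^ a⌉₊))ᶜ ≤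
            ENNReal.ofReal (Real.exp (-(β ^ (κ / 4)))) →
          c * (⌈β ^ ε⌉₊ : ℝ) ^ 3 * β ^ (-(2 : ℝ)) ≤ lagCov (coldKernel r β κ ⌈β ^ a⌉₊ η) (softLoopObs r ⌈β ^ ε⌉₊) ⌈β ^ ε⌉₊) →
      (∃ β₀ : ℝ, ∀ β : ℝ, β₀ ≤ β → ∀ η : LGConfig 4 G,
          (∀ p ∈ plaquettesTouching (lagBox ⌈β ^ a⌉₊),
            (r.N : ℝ) - plaquetteObs r.ρ p.1 p.2.1.1 p.2.1.2 η ≤ β ^ (κ / 2 - 1)) →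
          ymSpecification (d := 4) r.ρ β (lagBox ⌈β ^ a⌉₊) η (coldEvent r β κ (lagBox ⌈β ^ a⌉₊))ᶜ ≤
            ENNReal.ofReal (Real.exp (-(β ^ (κ / 4)))) →
          |condMean r β κ ⌈β ^ a⌉₊ (fun U => softLoopObs r ⌈β ^ ε⌉₊ (timeShiftLG (G := G) ⌈β ^ ε⌉₊ U)) η -
              condMean r β κ ⌈β ^ a⌉₊ (softLoopObs r ⌈β ^ ε⌉₊) η| ≤ ρ β) →
      ∃ β₀ : ℝ, ∀ β : ℝ, β₀ ≤ β → ∀ᶠ L : ℕ in atTop,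
        c / 8 * (⌈β ^ ε⌉₊ : ℝ) ^ 3 * β ^ (-(2 : ℝ)) ≤ torusLagCov r β L (softLoopObs r ⌈β ^ ε⌉₊) ⌈β ^ ε⌉₊ := by



  intro G _ _ _ _ _ _ r ε a κ c ρ hε hκ _hκ1 hc hwin hrate hfloor hsmooth
  obtain ⟨β₁, hfloor⟩ := hfloor
  obtain ⟨β₂, hsmooth⟩ := hsmooth
  obtain ⟨β₆, hrate⟩ := hrate (c / 8) (by positivity)
  have ha : 0 < a := by linarith
  -- the crude-good / typicality exponent `δ := κ/4` (antecedents of T′ rev 3)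
  set δ : ℝ := κ / 4 with hδdef
  have hδ : 0 < δ := by rw [hδdef]; positivity
  have h2δ : 2 * δ < κ := by rw [hδdef]; linarith
  have hexp : 2 * δ - 1 = κ / 2 - 1 := by rw [hδdef]; ring
  obtain ⟨β₃, hrare⟩ := plaquetteLargeFieldRarityG_of_latticeRep r hδ
  -- the intermediate rarity exponent `δ < δ' < κ/2` (ramp between `β^{2δ'-1}` and `β^{κ-1}`)
  set δ' : ℝ := (κ + 2 * δ) / 4 with hδ'def
  have hδ' : 0 < δ' := by rw [hδ'def]; linarith
  have hδδ' : 0 < δ' - δ := by rw [hδ'def]; linarith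
  have h2δ' : 2 * δ' - 1 < κ - 1 := by rw [hδ'def]; linarith
  obtain ⟨β₄, hrare'⟩ := plaquetteLargeFieldRarityG_of_latticeRep r hδ'
  haveI : SecondCountableTopology G := r.secondCountableTopology
  -- the asymptotic thresholds
  have hE2 : ∀ᶠ β : ℝ in atTop, Real.exp (-(β ^ δ)) ≤ 8⁻¹ := by
    have ht : Tendsto (fun β : ℝ => Real.exp (-(β ^ δ))) atTop (𝓝 0) :=
      Real.tendsto_exp_neg_atTop_nhds_zero.comp (tendsto_rpow_atTop hδ)
    exact ht.eventually (eventually_le_nhds (by norm_num))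
  set CJ : ℝ := (8 * c + 1171875) * 76832 with hCJ
  have hCJ0 : 0 < CJ := by positivity
  have hE4 : ∀ᶠ β : ℝ in atTop, CJ * (β ^ (5 * ε + 4 * a + 2) * Real.exp (-(β ^ δ))) ≤ c / 16 := by
    have ht := (tendsto_rpow_mul_exp_neg_rpow (5 * ε + 4 * a + 2) hδ).const_mul CJ
    rw [mul_zero] at ht
    exact ht.eventually (eventually_le_nhds (by positivity))
  have hE5 : ∀ᶠ β : ℝ in atTop, (2 : ℝ) ≤ β ^ (δ' - δ) := (tendsto_rpow_atTop hδδ').eventually_ge_atTop 2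
  obtain ⟨β₅, hβ₅⟩ := Filter.eventually_atTop.1 (hE2.and (hE4.and hE5))
  refine ⟨max (max (max β₁ β₂) (max β₃ β₄)) (max (max β₅ β₆) 2), fun β hβ => ?_⟩
  simp only [max_le_iff] at hβ
  obtain ⟨⟨⟨hb1, hb2⟩, hb3, hb4⟩, ⟨hb5, hb8⟩, hb7⟩ := hβ
  have hb6 : (1 : ℝ) ≤ β := by linarith
  have hb1' : (1 : ℝ) < β := by linarith
  have hβ0 : 0 < β := by linarith
  obtain ⟨hA2, hA4, hA5⟩ := hβ₅ β hb5
  obtain ⟨hid1, -⟩ := rpow_window_identities (ε := ε) (a := a) (δ := δ) (g := 2 * a - 13 * ε - 4 * δ) hβ0 rfl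
  have hrateβ := hrate β hb8
  set R : ℕ := ⌈β ^ ε⌉₊ with hR
  set n : ℕ := ⌈β ^ a⌉₊ with hn
  -- sizes of `R`, `n`, the observable bound `B`, the floor `θ₀`, the scale `Y`
  have hu1 : 1 ≤ β ^ ε := Real.one_le_rpow hb6 hε.le
  have hu0 : 0 < β ^ ε := by positivity
  have hRge : β ^ ε ≤ (R : ℝ) := Nat.le_ceil _
  have hRle : (R : ℝ) ≤ 2 * β ^ ε := (one_le_ceil_rpow_and_le hb6 hε.le).2
  have hva1 : 1 ≤ β ^ a := Real.one_le_rpow hb6 ha.le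
  have hva0 : 0 < β ^ a := by positivity
  have hnge : β ^ a ≤ (n : ℝ) := Nat.le_ceil _
  have hnle : (n : ℝ) ≤ 2 * β ^ a := (one_le_ceil_rpow_and_le hb6 ha.le).2
  have hn0 : (0 : ℝ) < n := lt_of_lt_of_le hva0 hnge
  have hβm2 : 0 < β ^ (-(2 : ℝ)) := Real.rpow_pos_of_pos hβ0 _
  have hβm2' : β ^ (-(2 : ℝ)) ≤ 1 := Real.rpow_le_one_of_one_le_of_nonpos hb6 (by norm_num)
  set B : ℝ := (2 * (R : ℝ) + 1) ^ 4 with hB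
  set θ₀ : ℝ := c * (R : ℝ) ^ 3 * β ^ (-(2 : ℝ)) with hθ₀
  set Y : ℝ := (β ^ ε) ^ 3 * β ^ (-(2 : ℝ)) with hY
  set e : ℝ := Real.exp (-(β ^ δ)) with hedef
  have he0 : 0 < e := Real.exp_pos _
  have hY0 : 0 < Y := by positivity
  have hθY : c * Y ≤ θ₀ := by
    rw [hθ₀, hY, ← mul_assoc]
    exact mul_le_mul_of_nonneg_right (mul_le_mul_of_nonneg_left (pow_le_pow_left₀ hu0.le hRge 3) hc.le) hβm2.le
  have hθ0 : 0 ≤ θ₀ := by positivity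
  have hB0 : 0 ≤ B := by positivity
  have hBle : B ≤ 625 * (β ^ ε) ^ 4 := by
    have h5 : 2 * (R : ℝ) + 1 ≤ 5 * β ^ ε := by linarith
    calc B = (2 * (R : ℝ) + 1) ^ 4 := hB
      _ ≤ (5 * β ^ ε) ^ 4 := pow_le_pow_left₀ (by positivity) h5 4
      _ = 625 * (β ^ ε) ^ 4 := by ring
  have hB2le : B ^ 2 ≤ 390625 * (β ^ ε) ^ 8 := by
    calc B ^ 2 ≤ (625 * (β ^ ε) ^ 4) ^ 2 := pow_le_pow_left₀ hB0 hBle 2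
      _ = 390625 * (β ^ ε) ^ 8 := by ring
  have hθle : θ₀ ≤ 8 * c * (β ^ ε) ^ 8 := by
    have hR3 : (R : ℝ) ^ 3 ≤ (2 * β ^ ε) ^ 3 := pow_le_pow_left₀ (by positivity) hRle 3
    have h38 : (β ^ ε) ^ 3 ≤ (β ^ ε) ^ 8 := pow_le_pow_right₀ hu1 (by norm_num)
    calc θ₀ = c * (R : ℝ) ^ 3 * β ^ (-(2 : ℝ)) := hθ₀
      _ ≤ c * (2 * β ^ ε) ^ 3 * 1 := mul_le_mul (mul_le_mul_of_nonneg_left hR3 hc.le) hβm2' hβm2.le (by positivity)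
      _ = 8 * c * (β ^ ε) ^ 3 := by ring
      _ ≤ 8 * c * (β ^ ε) ^ 8 := mul_le_mul_of_nonneg_left h38 (by positivity)
  have hn4 : (2 * (n : ℝ) + 3) ^ 4 ≤ 2401 * (β ^ a) ^ 4 := by
    have h7 : 2 * (n : ℝ) + 3 ≤ 7 * β ^ a := by linarith
    calc (2 * (n : ℝ) + 3) ^ 4 ≤ (7 * β ^ a) ^ 4 := pow_le_pow_left₀ (by positivity) h7 4
      _ = 2401 * (β ^ a) ^ 4 := by ring
  -- the junk terms: `J5 = (θ₀ + 3B²)·32(2n+3)⁴·e ≤ (c/16)·Y`, `ε₀² / 2 ≤ (c/16)·Y`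
  set p : ℝ := 32 * (2 * (n : ℝ) + 3) ^ 4 * e with hp
  have hp0 : 0 ≤ p := by positivity
  have hJ5 : (θ₀ + 3 * B ^ 2) * p ≤ c / 16 * Y := by
    have h1 : θ₀ + 3 * B ^ 2 ≤ (8 * c + 1171875) * (β ^ ε) ^ 8 := by linarith
    have h2 : p ≤ 76832 * (β ^ a) ^ 4 * e := by
      have h := mul_le_mul_of_nonneg_right hn4 (show (0 : ℝ) ≤ 32 * e by positivity)
      rw [hp]; linarith
    have h3 : (8 * c + 1171875) * (β ^ ε) ^ 8 * (76832 * (β ^ a) ^ 4 * e) = CJ * (β ^ (5 * ε + 4 * a + 2) * e) * Y := by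
      have e1 : CJ * (β ^ (5 * ε + 4 * a + 2) * e) * Y = CJ * e * (β ^ (5 * ε + 4 * a + 2) * Y) := by ring
      rw [e1, hid1, hCJ]; ring
    calc (θ₀ + 3 * B ^ 2) * p ≤ (8 * c + 1171875) * (β ^ ε) ^ 8 * (76832 * (β ^ a) ^ 4 * e) :=
          mul_le_mul h1 h2 hp0 (by positivity)
      _ = CJ * (β ^ (5 * ε + 4 * a + 2) * e) * Y := h3
      _ ≤ c / 16 * Y := mul_le_mul_of_nonneg_right hA4 hY0.le
  have hB2e : 0 ≤ B ^ 2 * e := by positivity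
  have h48 : 48 * B ^ 2 * e ≤ (θ₀ + 3 * B ^ 2) * p := by
    have h16 : (16 : ℝ) ≤ 32 * (2 * (n : ℝ) + 3) ^ 4 := by
      have : (1 : ℝ) ≤ (2 * (n : ℝ) + 3) ^ 4 := one_le_pow₀ (by linarith)
      linarith
    have h16e : 16 * e ≤ p := by rw [hp]; exact mul_le_mul_of_nonneg_right h16 he0.le
    have h3 : 3 * B ^ 2 * (16 * e) ≤ 3 * B ^ 2 * p := mul_le_mul_of_nonneg_left h16e (by positivity)
    have h4 : 0 ≤ θ₀ * p := mul_nonneg hθ0 hp0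
    linarith
  set ε₀ : ℝ := ρ β with hε₀
  have hJ3 : ε₀ ^ 2 / 2 ≤ θ₀ / 16 := by
    have h1 : ρ β ^ 2 ≤ θ₀ / 8 := by rw [hθ₀]; linarith
    rw [hε₀]; linarith
  -- the ramp thresholds `t' = β^{2δ'-1} < t = β^{κ-1}` and `e^{-β^{δ'}} ≤ e²`
  have htt : β ^ (2 * δ' - 1) < β ^ (κ - 1) := Real.rpow_lt_rpow_of_exponent_lt hb1' h2δ'
  have hee : Real.exp (-(β ^ δ')) ≤ e * e := by
    rw [hedef, ← Real.exp_add]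
    refine Real.exp_le_exp.2 ?_
    have hsplit : β ^ δ' = β ^ (δ' - δ) * β ^ δ := by
      rw [← Real.rpow_add hβ0]; ring_nf
    have hβδ : 0 ≤ β ^ δ := Real.rpow_nonneg hβ0.le _
    linarith [mul_le_mul_of_nonneg_right hA5 hβδ, hsplit]
  -- eventually in the torus size
  filter_upwards [hrare β hb3, hrare' β hb4, eventually_gt_atTop (2 * (n + 6 * R + 2))] with L hL2 hL2' hLbig
  haveI := isProbabilityMeasure_wilsonMeasure (d := 4) (L := L + 1) (G := G) r.ρ r.continuous β
  rw [torusLagCov_eq_boxKernel r β (n := n) (Nat.lt_succ_of_lt hLbig)]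
  -- the kernel quantities
  set Λ : Finset (QuantumLattice.ZdEdge 4) := lagBox n with hΛ
  set F : LGConfig 4 G → ℝ := softLoopObs r R with hF
  set h : GaugeConfig 4 (L + 1) G → ℝ := fun U => ∫ W, F W ∂(ymSpecification r.ρ β Λ (torusLift (L + 1) U)) with hh
  set k : GaugeConfig 4 (L + 1) G → ℝ :=
    fun U => ∫ W, F (timeShiftLG (G := G) R W) ∂(ymSpecification r.ρ β Λ (torusLift (L + 1) U)) with hk
  set q : GaugeConfig 4 (L + 1) G → ℝ :=
    fun U => ∫ W, F W * F (timeShiftLG (G := G) R W) ∂(ymSpecification r.ρ β Λ (torusLift (L + 1) U)) with hq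
  have hFc : Continuous F := continuous_softLoopObs r R
  have hFc' : Continuous fun U => F (timeShiftLG (G := G) R U) := hFc.comp (continuous_timeShiftLG R)
  have hqc : Continuous fun U => F U * F (timeShiftLG (G := G) R U) := hFc.mul hFc'
  have hFK : ∀ U, |F U| ≤ B := abs_softLoopObs_le' r R
  have hFK' : ∀ U, |F (timeShiftLG (G := G) R U)| ≤ B := fun U => abs_softLoopObs_le' r R _
  have hqK : ∀ U, |F U * F (timeShiftLG (G := G) R U)| ≤ B ^ 2 := abs_softLoopObs_mul_le r R R
  have hml := measurable_torusLift (d := 4) (G := G) (L + 1)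
  have hhm : Measurable h := (continuous_integral_ymSpecification r.ρ r.continuous β Λ hFc hFK).measurable.comp hml
  have hkm : Measurable k := (continuous_integral_ymSpecification r.ρ r.continuous β Λ hFc' hFK').measurable.comp hml
  have hqm : Measurable q := (continuous_integral_ymSpecification r.ρ r.continuous β Λ hqc hqK).measurable.comp hml
  have hhK : ∀ U, |h U| ≤ B := fun U => abs_integral_ymSpecification_le r.ρ r.continuous β Λ hFK _
  have hkK : ∀ U, |k U| ≤ B := fun U => abs_integral_ymSpecification_le r.ρ r.continuous β Λ hFK' _
  have hqK' : ∀ U, |q U| ≤ B ^ 2 := fun U => abs_integral_ymSpecification_le r.ρ r.continuous β Λ hqK _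
  -- the bad event (crude-bad data ∪ data whose kernel charges the hot ramp by more than `e`) and its mass
  set E₁ : Set (GaugeConfig 4 (L + 1) G) := {U | torusLift (L + 1) U ∈
      ⋃ p ∈ plaquettesTouching (lagBox n),
        {W : LGConfig 4 G | β ^ (2 * δ - 1) < plaqCostAt r.ρ p.1 p.2.1.1 p.2.1.2 W}} with hE₁
  set Φ : LGConfig 4 G → ℝ := fun W => ∑ p ∈ plaquettesTouching Λ,
      max 0 (min 1 ((plaqCostAt r.ρ p.1 p.2.1.1 p.2.1.2 W - β ^ (2 * δ' - 1)) / (β ^ (κ - 1) - β ^ (2 * δ' - 1)))) with hΦ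
  set gΦ : GaugeConfig 4 (L + 1) G → ℝ := fun U => ∫ W, Φ W ∂(ymSpecification r.ρ β Λ (torusLift (L + 1) U)) with hgΦ
  set E₂ : Set (GaugeConfig 4 (L + 1) G) := {U | e < gΦ U} with hE₂
  set E : Set (GaugeConfig 4 (L + 1) G) := E₁ ∪ E₂ with hE
  have hE₁m : MeasurableSet E₁ := hml (measurableSet_badSet_lagBox r β δ n)
  have hgΦm : Measurable gΦ :=
    (continuous_integral_ymSpecification r.ρ r.continuous β Λ (continuous_ramp r _ _ Λ)
      (abs_ramp_le_card r _ _ Λ)).measurable.comp hml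
  have hE₂m : MeasurableSet E₂ := measurableSet_lt measurable_const hgΦm
  have hEm : MeasurableSet E := hE₁m.union hE₂m
  have hgood : ∀ U, U ∉ E → CrudeGoodCorona r β δ n (torusLift (L + 1) U) := fun U hU =>
    crudeGoodCorona_of_not_mem_badSet r fun h' => hU (Set.mem_union_left _ h')
  have htypU : ∀ U, U ∉ E → ymSpecification (d := 4) r.ρ β (lagBox n) (torusLift (L + 1) U)
      (coldEvent r β κ (lagBox n))ᶜ ≤ ENNReal.ofReal e := by
    intro U hU
    have hU2 : gΦ U ≤ e := not_lt.1 fun h' => hU (Set.mem_union_right _ h')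
    haveI : IsProbabilityMeasure (ymSpecification (d := 4) r.ρ β (lagBox n) (torusLift (L + 1) U)) :=
      isProbabilityMeasure_ymSpecification r.ρ r.continuous β _ _
    have hreal : (ymSpecification (d := 4) r.ρ β (lagBox n) (torusLift (L + 1) U)).real (coldEvent r β κ (lagBox n))ᶜ ≤ e :=
      (measureReal_compl_coldEvent_le_integral_ramp r htt (lagBox n) _).trans hU2
    rw [← ofReal_measureReal (measure_ne_top _ _)]
    exact ENNReal.ofReal_le_ofReal hreal
  have hμE : (wilsonMeasure (d := 4) (L := L + 1) r.ρ β).real E ≤ p := by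
    have h1 : (wilsonMeasure (d := 4) (L := L + 1) r.ρ β).real E₁ ≤ 16 * (2 * (n : ℝ) + 3) ^ 4 * e :=
      measureReal_badSet_lagBox_le r hL2
    have h2 : (wilsonMeasure (d := 4) (L := L + 1) r.ρ β).real E₂ ≤
        16 * (2 * (n : ℝ) + 3) ^ 4 * Real.exp (-(β ^ δ')) / e :=
      measureReal_kernelRamp_gt_le r he0 htt (Nat.lt_succ_of_lt hLbig) hL2'
    have h3 : 16 * (2 * (n : ℝ) + 3) ^ 4 * Real.exp (-(β ^ δ')) / e ≤ 16 * (2 * (n : ℝ) + 3) ^ 4 * e := by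
      rw [div_le_iff₀ he0]
      have h := mul_le_mul_of_nonneg_left hee (show (0 : ℝ) ≤ 16 * (2 * (n : ℝ) + 3) ^ 4 by positivity)
      calc 16 * (2 * (n : ℝ) + 3) ^ 4 * Real.exp (-(β ^ δ')) ≤ 16 * (2 * (n : ℝ) + 3) ^ 4 * (e * e) := h
        _ = 16 * (2 * (n : ℝ) + 3) ^ 4 * e * e := by ring
    have hun := measureReal_union_le (μ := wilsonMeasure (d := 4) (L := L + 1) r.ρ β) E₁ E₂
    rw [hp]
    linarith
  -- off the bad event: the inner step
  set θ : ℝ := (1 - e) * θ₀ - 5 * B ^ 2 * e with hθ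
  have he2 : e ≤ 2⁻¹ := hA2.trans (by norm_num)
  have inner : ∀ U, U ∉ E → θ ≤ q U - h U * k U ∧ |k U - h U| ≤ ε₀ + 2 * B * e := by
    intro U hU
    have hg' := hgood U hU
    have hg'' : ∀ p ∈ plaquettesTouching (lagBox n),
        (r.N : ℝ) - plaquetteObs r.ρ p.1 p.2.1.1 p.2.1.2 (torusLift (L + 1) U) ≤ β ^ (κ / 2 - 1) := fun p hp => by
      have h := hg' p hp
      rwa [hexp] at h
    have hsm : (2 : ENNReal)⁻¹ ≤ ymSpecification (d := 4) r.ρ β (lagBox n) (torusLift (L + 1) U)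
        (coldEvent r β κ (lagBox n)) →
        |condMean r β κ n (fun U => softLoopObs r R (timeShiftLG (G := G) R U)) (torusLift (L + 1) U) -
            condMean r β κ n (softLoopObs r R) (torusLift (L + 1) U)| ≤ ε₀ := fun _ =>
      hsmooth β hb2 _ hg'' (htypU U hU)
    exact boxKernel_lagCov_ge_of_coldTypical r (htypU U hU) he0.le he2 hθ0 (fun _ => hfloor β hb1 _ hg'' (htypU U hU)) hsm
  have hθe : θ₀ * e ≤ θ₀ * 8⁻¹ := mul_le_mul_of_nonneg_left hA2 hθ0
  have hθl : 0 ≤ θ := by rw [hθ]; linarith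
  have key := total_covariance_lower_bound_sub hEm hhm hkm hqm hhK hkK hqK' hθl (fun U hU => (inner U hU).1)
    (fun U hU => (inner U hU).2) hμE
  -- window arithmetic
  have hε2 : (ε₀ + 2 * B * e) ^ 2 / 4 ≤ θ₀ / 16 + c / 16 * Y := by
    have hsq : (ε₀ + 2 * B * e) ^ 2 ≤ 2 * ε₀ ^ 2 + 8 * (B ^ 2 * e) := by
      have he1 : e ≤ 1 := hA2.trans (by norm_num)
      have h1 : (ε₀ + 2 * B * e) ^ 2 = 2 * ε₀ ^ 2 + 8 * (B ^ 2 * (e * e)) - (ε₀ - 2 * B * e) ^ 2 := by ring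
      have h2 : B ^ 2 * (e * e) ≤ B ^ 2 * e := mul_le_mul_of_nonneg_left (mul_le_of_le_one_right he0.le he1) (sq_nonneg B)
      rw [h1]
      linarith [sq_nonneg (ε₀ - 2 * B * e)]
    linarith
  have hθe0 : 0 ≤ θ₀ * e := mul_nonneg hθ0 he0.le
  have hbad : (θ + 3 * B ^ 2) * p ≤ c / 16 * Y := by
    have hθle' : θ ≤ θ₀ := by rw [hθ]; linarith
    exact (mul_le_mul_of_nonneg_right (by linarith) hp0).trans hJ5
  have hθge : θ₀ - θ₀ * 8⁻¹ - c / 16 * Y ≤ θ := by rw [hθ]; linarith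
  have hgoal : c / 8 * (R : ℝ) ^ 3 * β ^ (-(2 : ℝ)) ≤ (∫ U, q U ∂(wilsonMeasure (d := 4) (L := L + 1) r.ρ β)) -
      (∫ U, h U ∂(wilsonMeasure (d := 4) (L := L + 1) r.ρ β)) * ∫ U, k U ∂(wilsonMeasure (d := 4) (L := L + 1) r.ρ β) := by
    have e8 : c / 8 * (R : ℝ) ^ 3 * β ^ (-(2 : ℝ)) = θ₀ / 8 := by rw [hθ₀]; ring
    rw [e8]
    linarith
  exact hgoal

end Summit.QuantumFields.YangMills.Theorems.SoftLoopLongLag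

end
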